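import Literature.Probability.RandomPlanarGeometry.SAWAdsorptionUpperBound
import HarnessLib

/-!
# Wall-returning `x`-bridges of the half-plane self-avoiding walk: the adsorption renewal inequality
# and the irreducible-piece certificate principle for `AdsorbedAbove a Λ`

Topic `Literature/Probability/RandomPlanarGeometry` (continues `SAWAdsorptionUpperBound.lean` — the half-plane walks
`hpWalks n` on `ℤ²` with the wall `x₀ = 0`, the wall-visit count `wallVisits`, the adsorption partition function
`adsZ n a = Z⁺_n(a) = Σ_ω a^{v(ω)}` and the finite statement `AdsorbedAbove a Λ : ∃ K > 0, ∀ n, K Λⁿ ≤ Z⁺_n(a)` of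
Hammersley–Torrie–Whittington 1982 / Beaton–Guttmann–Jensen 2012 — and `SAWWords.lean`, the step-word model
`traj`, `wEnd`, `IsSAW`, `words n`).

## The objects

A **wall-returning `x`-bridge** (piece) is a self-avoiding step word `w` of length `m` from the origin with
`x₀ ≥ 0` throughout, ending ON the wall (`x₀ = 0` at time `m`), whose coordinate along the wall satisfies
`0 = x₁(0) ≤ x₁(k)` for all `k` and `x₁(k) < x₁(m)` for `k < m` (`AdsIrr.IsWXB`; the empty word is one). Two pieces
concatenate to a piece (`AdsIrr.IsWXB.append`: the first lies in `x₁ < x₁(m)`, the second in `x₁ ≥ x₁(m)`), and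
wall visits add (`AdsIrr.visits_append`). A **renewal time** of `w` is a `0 < k < m` at which both `w.take k` and
`w.drop k` are pieces; a nonempty piece with no renewal time is **irreducible** (`AdsIrr.IsIrr`). With
`B_n(a) := Σ_{pieces of length n} a^{visits}` (`AdsIrr.Bw`) and `F_m(a) := Σ_{irreducible, length m} a^{visits}`
(`AdsIrr.Fw`):

* `AdsIrr.sum_Fw_mul_Bw_le_Bw` — the **renewal inequality** `Σ_{m=1}^{n} F_m(a) B_{n-m}(a) ≤ B_n(a)` (`a ≥ 0`):
  `(irreducible p, piece b) ↦ p ++ b` is injective, and its images for different `|p|` are disjoint because a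
  coincidence `p ++ b = p' ++ b'` with `|p| < |p'|` would make `|p|` a renewal time of `p'`
  (`AdsIrr.isWXB_of_between`);
* `AdsIrr.Bw_le_adsZ` — `B_n(a) ≤ Z⁺_n(a)` (pieces are half-plane walks; `AdsIrr.visits` is `wallVisits`);
* `AdsIrr.adsorbedAbove_of_irreducible_lowerBounds` — the **certificate principle**: if `f_m ≤ F_m(a)` for
  `1 ≤ m ≤ L` and `Σ_{m=1}^{L} f_m Λ^{-m} ≥ 1` (`a, Λ > 0`), then `AdsorbedAbove a Λ`, with
  `K = min_{n<L} B_n(a) Λ^{-n} > 0` (the walk along the wall gives `B_n(a) ≥ aⁿ > 0`) and the strong induction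
  `B_n ≥ Σ_{m≤L} f_m B_{n-m} ≥ K Λⁿ Σ_{m≤L} f_m Λ^{-m} ≥ K Λⁿ`.

This is the renewal structure of bridges (Kesten 1963; Madras–Slade 1993 §4.2, (4.2.2)) transported to the
adsorption problem: the lower bounds `f_m` are supplied by kernel-certified counts of irreducible pieces by length
and number of wall visits (`SAWAdsorptionUpperBound209.lean`), exactly as the tree's `μ(𝕋) > 3.94`-type
certificates use irreducible bridges (`SAWTriangularConnectiveConstantLower.lean`). No renewal EQUALITY is needed.
-/

open Finset Literature.Probability.LatticeModels SimpleGraph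
open scoped BigOperators

namespace Literature.Probability.RandomPlanarGeometry.SAW

namespace AdsIrr

/-! ### Pieces, visits, irreducible pieces -/

/-- **Wall-returning `x`-bridge** (as a step word from the origin; wall `x₀ = 0`, half-plane `x₀ ≥ 0`):
self-avoiding, `x₀ ≥ 0` throughout, ends on the wall, and `0 ≤ x₁(k)` for all `k`, `x₁(k) < x₁(|w|)` for
`k < |w|`. Decidable. [cite: BeatonGuttmannJensen2012Adsorption, §1 (p. 2)] [cite: MadrasSlade1993, Definition 1.2.4 (p. 10)] -/
def IsWXB (w : List Step) : Prop :=
  IsSAW w ∧ (∀ i ≤ w.length, 0 ≤ traj w i 0) ∧ wEnd w 0 = 0 ∧ (∀ i ≤ w.length, 0 ≤ traj w i 1) ∧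
    ∀ i < w.length, traj w i 1 < wEnd w 1

/-- `IsWXB` is decidable. [folklore] -/
instance : DecidablePred IsWXB := fun w => by unfold IsWXB; infer_instance

/-- Number of wall visits at times `1, …, |w|` (vertex weights), computably.
[cite: BeatonGuttmannJensen2012Adsorption, §1 (p. 2)] -/
def visits (w : List Step) : ℕ := ∑ j ∈ range w.length, if traj w (j + 1) 0 = 0 then 1 else 0

/-- **Irreducible piece**: a nonempty piece with no renewal time, i.e. no `0 < k < |w|` at which both `w.take k`
and `w.drop k` are pieces. Decidable. [cite: MadrasSlade1993, Definition 4.2.1 (p. 89)] -/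
def IsIrr (w : List Step) : Prop :=
  IsWXB w ∧ w ≠ [] ∧ ∀ k < w.length, 0 < k → ¬ (IsWXB (w.take k) ∧ IsWXB (w.drop k))

/-- `IsIrr` is decidable. [folklore] -/
instance : DecidablePred IsIrr := fun w => by unfold IsIrr; infer_instance

/-- The pieces of length `n`. [cite: BeatonGuttmannJensen2012Adsorption, §1 (p. 2)] -/
def wxbWords (n : ℕ) : Finset (List Step) := (words n).filter IsWXB

/-- The irreducible pieces of length `n`. [cite: MadrasSlade1993, Definition 4.2.1 (p. 89)] -/
def irrWords (n : ℕ) : Finset (List Step) := (words n).filter IsIrr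

/-- `B_n(a) = Σ_{pieces of length n} a^{visits}`. [cite: BeatonGuttmannJensen2012Adsorption, §1 (p. 2)] -/
noncomputable def Bw (n : ℕ) (a : ℝ) : ℝ := ∑ w ∈ wxbWords n, a ^ visits w

/-- `F_m(a) = Σ_{irreducible pieces of length m} a^{visits}`. [cite: MadrasSlade1993, Definition 4.2.1 (p. 89)] -/
noncomputable def Fw (m : ℕ) (a : ℝ) : ℝ := ∑ w ∈ irrWords m, a ^ visits w

/-- Membership in `wxbWords n`. [cite: MadrasSlade1993, §1.2 (p. 10)] -/
@[simp] theorem mem_wxbWords {n : ℕ} {w : List Step} : w ∈ wxbWords n ↔ w.length = n ∧ IsWXB w := by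
  simp [wxbWords]

/-- Membership in `irrWords n`. [cite: MadrasSlade1993, §1.2 (p. 10)] -/
@[simp] theorem mem_irrWords {n : ℕ} {w : List Step} : w ∈ irrWords n ↔ w.length = n ∧ IsIrr w := by
  simp [irrWords]

/-- `B_n(a) ≥ 0` for `a ≥ 0`. [cite: MadrasSlade1993, §1.2 (p. 10)] -/
theorem Bw_nonneg (n : ℕ) {a : ℝ} (ha : 0 ≤ a) : 0 ≤ Bw n a :=
  Finset.sum_nonneg fun _ _ => pow_nonneg ha _

/-- `F_m(a) ≥ 0` for `a ≥ 0`. [cite: MadrasSlade1993, §1.2 (p. 10)] -/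
theorem Fw_nonneg (m : ℕ) {a : ℝ} (ha : 0 ≤ a) : 0 ≤ Fw m a :=
  Finset.sum_nonneg fun _ _ => pow_nonneg ha _

/-! ### Coordinates of endpoints and trajectories -/

/-- Coordinate `0` (height above the wall) of a translate. [folklore] -/
private theorem add_apply_zero (x y : Site 2) : (x + y) 0 = x 0 + y 0 := rfl

/-- Coordinate `1` (along the wall) of a translate. [folklore] -/
private theorem add_apply_one (x y : Site 2) : (x + y) 1 = x 1 + y 1 := rfl

/-- The empty word is a piece. [cite: MadrasSlade1993, §1.2 (p. 10)] -/
theorem isWXB_nil : IsWXB [] := by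
  refine ⟨isSAW_nil, ?_, by simp, ?_, fun i hi => absurd hi (Nat.not_lt_zero _)⟩
  · intro i _; simp [traj]
  · intro i _; simp [traj]

/-- **Concatenation of pieces is a piece.** [cite: BeatonGuttmannJensen2012Adsorption, §1 (p. 2)]
[cite: MadrasSlade1993, §1.2 (p. 10)] -/
theorem IsWXB.append {u v : List Step} (hu : IsWXB u) (hv : IsWXB v) : IsWXB (u ++ v) := by
  obtain ⟨hus, huh, hue, hux, hur⟩ := hu
  obtain ⟨hvs, hvh, hve, hvx, hvr⟩ := hv
  have hv0x : 0 ≤ wEnd v 1 := by have := hvx v.length le_rfl; rwa [traj_length] at this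
  -- positions of the concatenation
  have left : ∀ i ≤ u.length, traj (u ++ v) i = traj u i := fun i hi => traj_append_left u v hi
  have right : ∀ j, traj (u ++ v) (u.length + j) = wEnd u + traj v j := fun j => traj_append_right u v j
  refine ⟨?_, ?_, ?_, ?_, ?_⟩
  · -- self-avoidance: the two halves live in `x₁ < wEnd u 1` and `x₁ ≥ wEnd u 1`
    rw [isSAW_iff_injOn]
    intro i hi j hj hij
    simp only [Set.mem_setOf_eq, List.length_append] at hi hj
    have hus' := (isSAW_iff_injOn u).1 hus
    have hvs' := (isSAW_iff_injOn v).1 hvs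
    rcases le_or_gt i u.length with hiu | hiu <;> rcases le_or_gt j u.length with hju | hju
    · rw [left i hiu, left j hju] at hij
      exact hus' (by simpa using hiu) (by simpa using hju) hij
    · exfalso
      obtain ⟨j', rfl⟩ := Nat.exists_eq_add_of_lt hju
      have h1 := congrFun hij 1
      rw [left i hiu, show u.length + j' + 1 = u.length + (j' + 1) by omega, right, add_apply_one] at h1
      rcases lt_or_eq_of_le hiu with hlt | heq
      · have := hur i hlt; have := hvx (j' + 1) (by omega); omega
      · subst heq
        rw [traj_length] at h1
        have h0 := congrFun hij 0
        rw [left _ le_rfl, traj_length, show u.length + j' + 1 = u.length + (j' + 1) by omega, right,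
          add_apply_zero] at h0
        have key : traj v 0 = traj v (j' + 1) := by
          funext t; fin_cases t
          · simp only [traj_zero]; show (0 : Site 2) 0 = traj v (j' + 1) 0; simp; omega
          · simp only [traj_zero]; show (0 : Site 2) 1 = traj v (j' + 1) 1; simp; omega
        have := hvs' (show 0 ∈ {i | i ≤ v.length} by simp) (show j' + 1 ∈ {i | i ≤ v.length} by
          simp only [Set.mem_setOf_eq]; omega) key
        omega
    · exfalso
      obtain ⟨i', rfl⟩ := Nat.exists_eq_add_of_lt hiu
      have h1 := congrFun hij 1
      rw [left j hju, show u.length + i' + 1 = u.length + (i' + 1) by omega, right, add_apply_one] at h1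
      rcases lt_or_eq_of_le hju with hlt | heq
      · have := hur j hlt; have := hvx (i' + 1) (by omega); omega
      · subst heq
        rw [traj_length] at h1
        have h0 := congrFun hij 0
        rw [left _ le_rfl, traj_length, show u.length + i' + 1 = u.length + (i' + 1) by omega, right,
          add_apply_zero] at h0
        have key : traj v 0 = traj v (i' + 1) := by
          funext t; fin_cases t
          · simp only [traj_zero]; show (0 : Site 2) 0 = traj v (i' + 1) 0; simp; omega
          · simp only [traj_zero]; show (0 : Site 2) 1 = traj v (i' + 1) 1; simp; omega
        have := hvs' (show 0 ∈ {i | i ≤ v.length} by simp) (show i' + 1 ∈ {i | i ≤ v.length} by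
          simp only [Set.mem_setOf_eq]; omega) key
        omega
    · obtain ⟨i', rfl⟩ := Nat.exists_eq_add_of_lt hiu
      obtain ⟨j', rfl⟩ := Nat.exists_eq_add_of_lt hju
      rw [show u.length + i' + 1 = u.length + (i' + 1) by omega, right,
        show u.length + j' + 1 = u.length + (j' + 1) by omega, right, add_right_inj] at hij
      have := hvs' (show i' + 1 ∈ {i | i ≤ v.length} by simp only [Set.mem_setOf_eq]; omega)
        (show j' + 1 ∈ {i | i ≤ v.length} by simp only [Set.mem_setOf_eq]; omega) hij
      omega
  · intro i hi
    rcases le_or_gt i u.length with hiu | hiu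
    · rw [left i hiu]; exact huh i hiu
    · obtain ⟨j, rfl⟩ := Nat.exists_eq_add_of_lt hiu
      rw [show u.length + j + 1 = u.length + (j + 1) by omega, right, add_apply_zero, hue, zero_add]
      exact hvh (j + 1) (by rw [List.length_append] at hi; omega)
  · rw [wEnd_append, add_apply_zero, hue, hve, add_zero]
  · intro i hi
    rcases le_or_gt i u.length with hiu | hiu
    · rw [left i hiu]; exact hux i hiu
    · obtain ⟨j, rfl⟩ := Nat.exists_eq_add_of_lt hiu
      rw [show u.length + j + 1 = u.length + (j + 1) by omega, right, add_apply_one]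
      have h1 := hux u.length le_rfl
      rw [traj_length] at h1
      have h2 := hvx (j + 1) (by rw [List.length_append] at hi; omega)
      omega
  · intro i hi
    rw [List.length_append] at hi
    rw [wEnd_append, add_apply_one]
    rcases lt_or_ge i u.length with hiu | hiu
    · rw [left i hiu.le]; have := hur i hiu; omega
    · obtain ⟨j, rfl⟩ := Nat.exists_eq_add_of_le hiu
      rw [right, add_apply_one]
      have := hvr j (by omega)
      omega

/-- **Wall visits add under concatenation** when the first word ends on the wall.
[cite: BeatonGuttmannJensen2012Adsorption, §1 (p. 2)] -/
theorem visits_append {u v : List Step} (hue : wEnd u 0 = 0) : visits (u ++ v) = visits u + visits v := by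
  unfold visits
  rw [List.length_append, Finset.sum_range_add]
  congr 1
  · refine Finset.sum_congr rfl fun j hj => ?_
    rw [Finset.mem_range] at hj
    rw [traj_append_left u v (show j + 1 ≤ u.length by omega)]
  · refine Finset.sum_congr rfl fun j _ => ?_
    rw [show u.length + j + 1 = u.length + (j + 1) by omega, traj_append_right, add_apply_zero, hue, zero_add]

/-- **The piece between two cuts**: if `p`, `p ++ c` and `c ++ d` are pieces then so is `c`.
[cite: MadrasSlade1993, §4.2 (p. 89)] -/
theorem isWXB_of_between {p c d : List Step} (hp : IsWXB p) (hpc : IsWXB (p ++ c)) (hcd : IsWXB (c ++ d)) :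
    IsWXB c := by
  obtain ⟨-, -, hpe, -, -⟩ := hp
  obtain ⟨-, -, hpce, -, hpcr⟩ := hpc
  obtain ⟨hcds, hcdh, -, hcdx, -⟩ := hcd
  have cleft : ∀ i ≤ c.length, traj (c ++ d) i = traj c i := fun i hi => traj_append_left c d hi
  refine ⟨?_, fun i hi => ?_, ?_, fun i hi => ?_, fun i hi => ?_⟩
  · have := hcds.take c.length
    rwa [List.take_left] at this
  · rw [← cleft i hi]; exact hcdh i (by rw [List.length_append]; omega)
  · rw [wEnd_append, add_apply_zero, hpe, zero_add] at hpce; exact hpce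
  · rw [← cleft i hi]; exact hcdx i (by rw [List.length_append]; omega)
  · have := hpcr (p.length + i) (by rw [List.length_append]; omega)
    rw [traj_append_right, add_apply_one, wEnd_append, add_apply_one] at this
    omega

/-! ### The renewal inequality -/

/-- The word along the wall (`n` east steps) is a piece with `B`-weight `aⁿ`; hence `B_n(a) > 0` for `a > 0`.
[cite: BeatonGuttmannJensen2012Adsorption, §1 (p. 2)] -/
theorem Bw_pos (n : ℕ) {a : ℝ} (ha : 0 < a) : 0 < Bw n a := by
  have hmem : List.replicate n (1 : Step) ∈ wxbWords n := by
    rw [mem_wxbWords]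
    refine ⟨List.length_replicate, ?_⟩
    have htraj : ∀ i ≤ n, traj (List.replicate n (1 : Step)) i = ![0, (i : ℤ)] := by
      intro i hi
      rw [traj, List.take_replicate, min_eq_left hi]
      induction i with
      | zero => simp; funext t; fin_cases t <;> rfl
      | succ i ih =>
        rw [List.replicate_succ, wEnd_cons, ih (by omega)]
        funext t; fin_cases t
        · simp [Step.vec, Step.dx, Step.dy]
        · simp [Step.vec, Step.dx, Step.dy]; ring
    have hend : wEnd (List.replicate n (1 : Step)) = ![0, (n : ℤ)] := by
      rw [← traj_length, List.length_replicate, htraj n le_rfl]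
    refine ⟨?_, fun i hi => ?_, ?_, fun i hi => ?_, fun i hi => ?_⟩
    · rw [isSAW_iff_injOn]; intro i hi j hj hij
      simp only [Set.mem_setOf_eq, List.length_replicate] at hi hj
      rw [htraj i hi, htraj j hj] at hij
      have := congrFun hij 1; simp at this; exact this
    · rw [List.length_replicate] at hi; rw [htraj i hi]; simp
    · rw [hend]; simp
    · rw [List.length_replicate] at hi; rw [htraj i hi]; simp
    · rw [List.length_replicate] at hi; rw [htraj i hi.le, hend]; simp; exact_mod_cast hi
  unfold Bw
  exact lt_of_lt_of_le (pow_pos ha _) (Finset.single_le_sum (fun _ _ => pow_nonneg ha.le _) hmem)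

/-- **The renewal inequality** `Σ_{m=1}^{n} F_m(a) B_{n-m}(a) ≤ B_n(a)` (`a ≥ 0`): concatenating an irreducible piece
of length `m` with a piece of length `n - m` is injective into the pieces of length `n`, with disjoint images for
different `m`, and multiplies the weights. (The reverse inequality — every piece splits at its first renewal
time — also holds but is not needed.) [cite: MadrasSlade1993, §4.2, eq. (4.2.2) (p. 89)] [cite: Kesten1963SAW, §4] -/
theorem sum_Fw_mul_Bw_le_Bw (n : ℕ) {a : ℝ} (ha : 0 ≤ a) :
    ∑ m ∈ Icc 1 n, Fw m a * Bw (n - m) a ≤ Bw n a := by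
  classical
  set S : Finset (Σ _ : ℕ, List Step × List Step) :=
    (Icc 1 n).sigma fun m => irrWords m ×ˢ wxbWords (n - m) with hS
  have hmemS : ∀ x ∈ S, x.1 ∈ Icc 1 n ∧ x.2.1.length = x.1 ∧ IsIrr x.2.1 ∧ x.2.2.length = n - x.1 ∧
      IsWXB x.2.2 := by
    rintro ⟨m, p, b⟩ hx
    simp only [hS, Finset.mem_sigma, Finset.mem_product, mem_irrWords, mem_wxbWords] at hx
    exact ⟨hx.1, hx.2.1.1, hx.2.1.2, hx.2.2.1, hx.2.2.2⟩
  -- rewrite the left side as a sum over `S`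
  have step1 : ∑ m ∈ Icc 1 n, Fw m a * Bw (n - m) a = ∑ x ∈ S, a ^ visits (x.2.1 ++ x.2.2) := by
    rw [hS, Finset.sum_sigma]
    refine Finset.sum_congr rfl fun m _ => ?_
    rw [Fw, Bw, Finset.sum_mul_sum, Finset.sum_product]
    refine Finset.sum_congr rfl fun p hp => Finset.sum_congr rfl fun b _ => ?_
    rw [visits_append (mem_irrWords.1 hp).2.1.2.2.1, pow_add]
  -- the concatenation map is injective on `S`
  have hinj : Set.InjOn (fun x : (Σ _ : ℕ, List Step × List Step) => x.2.1 ++ x.2.2) S := by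
    rintro ⟨m, p, b⟩ hx ⟨m', p', b'⟩ hx' h
    simp only at h
    obtain ⟨hm, hpl, hpI, hbl, hbW⟩ := hmemS _ hx
    obtain ⟨hm', hpl', hpI', hbl', hbW'⟩ := hmemS _ hx'
    simp only at hm hpl hpI hbl hbW hm' hpl' hpI' hbl' hbW'
    -- the key: equal lengths (otherwise the longer irreducible piece has a renewal time)
    have key : ∀ {m m' : ℕ} {p b p' b' : List Step}, m ∈ Icc 1 n → p.length = m → IsIrr p →
        IsWXB b → p'.length = m' → IsIrr p' → p ++ b = p' ++ b' → ¬ m < m' := by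
      intro m m' p b p' b' hm hpl hpI hbW hpl' hpI' h hlt
      have hpre : p' = p ++ b.take (m' - m) := by
        have h1 : (p ++ b).take m' = p ++ b.take (m' - m) := by
          rw [List.take_append, List.take_of_length_le (by omega : p.length ≤ m'), hpl]
        have h2 : (p' ++ b').take m' = p' := by
          rw [List.take_append_of_le_length (by omega : m' ≤ p'.length),
            List.take_of_length_le (by omega : p'.length ≤ m')]
        rw [← h2, ← h, h1]
      refine hpI'.2.2 m (by omega) (by rw [Finset.mem_Icc] at hm; omega) ⟨?_, ?_⟩
      · rw [hpre, List.take_append_of_le_length (by omega), List.take_of_length_le (by omega)]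
        exact hpI.1
      · rw [hpre, List.drop_append_of_le_length (by omega), List.drop_of_length_le (by omega),
          List.nil_append]
        refine isWXB_of_between hpI.1 ?_ (d := b.drop (m' - m)) ?_
        · rw [← hpre]; exact hpI'.1
        · rw [List.take_append_drop]; exact hbW
    have hmm : m = m' := by
      by_contra hne
      rcases Nat.lt_or_gt_of_ne hne with hlt | hlt
      · exact key hm hpl hpI hbW hpl' hpI' h hlt
      · exact key hm' hpl' hpI' hbW' hpl hpI h.symm hlt
    subst hmm
    obtain ⟨rfl, rfl⟩ := List.append_inj h (hpl.trans hpl'.symm)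
    rfl
  rw [step1, ← Finset.sum_image (f := fun w => a ^ visits w) hinj, Bw]
  refine Finset.sum_le_sum_of_subset_of_nonneg (fun w hw => ?_) fun _ _ _ => pow_nonneg ha _
  obtain ⟨x, hx, rfl⟩ := Finset.mem_image.1 hw
  obtain ⟨hm, hpl, hpI, hbl, hbW⟩ := hmemS x hx
  rw [Finset.mem_Icc] at hm
  exact mem_wxbWords.2 ⟨by rw [List.length_append, hpl, hbl]; omega, hpI.1.append hbW⟩

/-! ### Pieces are half-plane walks: `B_n(a) ≤ Z⁺_n(a)` -/

/-- `AdsIrr.visits w` is the tree's `wallVisits |w| (traj w)`. [cite: BeatonGuttmannJensen2012Adsorption, §1 (p. 2)] -/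
theorem visits_eq_wallVisits (w : List Step) : visits w = Zd.wallVisits w.length (traj w) := by
  classical
  unfold visits Zd.wallVisits
  rw [Finset.card_filter, Finset.sum_range_succ']
  have h0 : (if 1 ≤ 0 ∧ traj w 0 0 = 0 then 1 else 0) = 0 := if_neg (by omega)
  rw [h0, add_zero]
  refine Finset.sum_congr rfl fun j _ => ?_
  by_cases hz : traj w (j + 1) 0 = 0
  · rw [if_pos hz, if_pos ⟨by omega, hz⟩]
  · rw [if_neg hz, if_neg fun h => hz h.2]

/-- The trajectory of a piece of length `n` is a half-plane walk. [cite: BeatonGuttmannJensen2012Adsorption, §1 (p. 2)] -/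
theorem traj_mem_hpWalks {n : ℕ} {w : List Step} (hl : w.length = n) (hw : IsWXB w) : traj w ∈ Zd.hpWalks n := by
  classical
  unfold Zd.hpWalks
  rw [Finset.mem_filter]
  exact ⟨traj_mem_saws hl hw.1, fun i hi => hw.2.1 i (by omega)⟩

/-- **`B_n(a) ≤ Z⁺_n(a)`** (`a ≥ 0`): pieces inject into half-plane walks via `traj`, with the right weights.
[cite: BeatonGuttmannJensen2012Adsorption, §1 (p. 2)] [cite: MadrasSlade1993, §1.2 (p. 10)] -/
theorem Bw_le_adsZ (n : ℕ) {a : ℝ} (ha : 0 ≤ a) : Bw n a ≤ Zd.adsZ n a := by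
  classical
  have hmem : ∀ w ∈ wxbWords n, w.length = n ∧ IsWXB w := fun w hw => mem_wxbWords.1 hw
  calc Bw n a = ∑ w ∈ wxbWords n, a ^ Zd.wallVisits n (traj w) :=
        Finset.sum_congr rfl fun w hw => by rw [visits_eq_wallVisits, (hmem w hw).1]
    _ = ∑ ω ∈ (wxbWords n).image traj, a ^ Zd.wallVisits n ω := by
        rw [Finset.sum_image]
        intro w hw w' hw' h
        exact traj_injOn n (by simp [(hmem w hw).1]) (by simp [(hmem w' hw').1]) h
    _ ≤ ∑ ω ∈ Zd.hpWalks n, a ^ Zd.wallVisits n ω := by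
        refine Finset.sum_le_sum_of_subset_of_nonneg ?_ fun ω _ _ => pow_nonneg ha _
        intro ω hω
        obtain ⟨w, hw, rfl⟩ := Finset.mem_image.1 hω
        exact traj_mem_hpWalks (hmem w hw).1 (hmem w hw).2
    _ = Zd.adsZ n a := rfl

/-! ### The certificate principle -/

/-- A positive constant below `B_n(a) Λ^{-n}` for all `n < L`. [folklore] -/
private theorem exists_const_le_Bw (L : ℕ) {a Λ : ℝ} (ha : 0 < a) (hΛ : 0 < Λ) :
    ∃ K : ℝ, 0 < K ∧ ∀ n < L, K * Λ ^ n ≤ Bw n a := by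
  induction L with
  | zero => exact ⟨1, one_pos, fun n hn => absurd hn (Nat.not_lt_zero _)⟩
  | succ L ih =>
    obtain ⟨K, hK, hKle⟩ := ih
    refine ⟨min K (Bw L a / Λ ^ L), lt_min hK (div_pos (Bw_pos L ha) (pow_pos hΛ _)), fun n hn => ?_⟩
    rcases Nat.lt_succ_iff_lt_or_eq.1 hn with hlt | rfl
    · exact le_trans (mul_le_mul_of_nonneg_right (min_le_left _ _) (pow_nonneg hΛ.le _)) (hKle n hlt)
    · calc min K (Bw n a / Λ ^ n) * Λ ^ n ≤ Bw n a / Λ ^ n * Λ ^ n :=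
            mul_le_mul_of_nonneg_right (min_le_right _ _) (pow_nonneg hΛ.le _)
        _ = Bw n a := div_mul_cancel₀ _ (pow_ne_zero _ hΛ.ne')

/-- **The irreducible-piece certificate principle.** If `f m ≤ F_m(a)` for `1 ≤ m ≤ L` and
`Σ_{m=1}^{L} f m / Λ^m ≥ 1` (`a, Λ > 0`), then `K Λⁿ ≤ B_n(a) ≤ Z⁺_n(a)` for all `n` with some `K > 0`, i.e.
`AdsorbedAbove a Λ`. [cite: MadrasSlade1993, §4.2, eq. (4.2.2)–(4.2.4) (pp. 89–91)] [cite: Kesten1963SAW, §4]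
[cite: BeatonGuttmannJensen2012Adsorption, §1 (p. 2)] -/
theorem adsorbedAbove_of_irreducible_lowerBounds {a Λ : ℝ} (ha : 0 < a) (hΛ : 0 < Λ) {L : ℕ} (f : ℕ → ℝ)
    (hfF : ∀ m ∈ Icc 1 L, f m ≤ Fw m a)
    (hsum : 1 ≤ ∑ m ∈ Icc 1 L, f m / Λ ^ m) : Zd.AdsorbedAbove a Λ := by
  obtain ⟨K, hK, hKle⟩ := exists_const_le_Bw L ha hΛ
  have main : ∀ n, K * Λ ^ n ≤ Bw n a := by
    intro n
    induction n using Nat.strong_induction_on with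
    | _ n ih =>
      rcases lt_or_ge n L with hn | hn
      · exact hKle n hn
      · calc K * Λ ^ n = K * Λ ^ n * 1 := (mul_one _).symm
          _ ≤ K * Λ ^ n * ∑ m ∈ Icc 1 L, f m / Λ ^ m :=
              mul_le_mul_of_nonneg_left hsum (mul_nonneg hK.le (pow_nonneg hΛ.le _))
          _ = ∑ m ∈ Icc 1 L, f m * (K * Λ ^ (n - m)) := by
              rw [Finset.mul_sum]
              refine Finset.sum_congr rfl fun m hm => ?_
              rw [Finset.mem_Icc] at hm
              rw [pow_sub₀ _ hΛ.ne' (show m ≤ n by omega)]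
              field_simp
          _ ≤ ∑ m ∈ Icc 1 L, Fw m a * Bw (n - m) a := by
              refine Finset.sum_le_sum fun m hm => ?_
              have hm' := Finset.mem_Icc.1 hm
              exact mul_le_mul (hfF m hm) (ih (n - m) (by omega)) (mul_nonneg hK.le (pow_nonneg hΛ.le _))
                (Fw_nonneg m ha.le)
          _ ≤ ∑ m ∈ Icc 1 n, Fw m a * Bw (n - m) a :=
              Finset.sum_le_sum_of_subset_of_nonneg (Finset.Icc_subset_Icc_right hn)
                fun m _ _ => mul_nonneg (Fw_nonneg m ha.le) (Bw_nonneg _ ha.le)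
          _ ≤ Bw n a := sum_Fw_mul_Bw_le_Bw n ha.le
  exact ⟨K, hK, fun n => le_trans (main n) (Bw_le_adsZ n ha.le)⟩

end AdsIrr

end Literature.Probability.RandomPlanarGeometry.SAW
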